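import Summits.ResolutionOfSingularities.ResolutionOfSingularities.Theorems.PurelyInseparableDim4ResConeLossyTiltFreeSeed
import Summits.ResolutionOfSingularities.ResolutionOfSingularities.Theorems.PurelyInseparableDim4StraighteningChart
import Summits.ResolutionOfSingularities.ResolutionOfSingularities.Theorems.PurelyInseparableDim4IsolationAutomorphism
import HarnessLib
import HarnessLib.Audit.Tags

/-!
# Purely inseparable four-folds — FRAME CONJUGATION: a point step read in MOVING LINEAR FRAMES is the
# pure-shear step of the parent re-coordinatised by its linear frame plus ONE QUADRATIC CONTACT TERM
# (K2(p) lane, SLICE C, brick (ii) «tilted reduction», FILE 3a: pure algebra; file-holder res-dim4-p-5 g4)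

[OURS · counted 0 · cell `res-dim4-pi` · K2(p) lane, slice C (desk WORD #155) · seat p-5 g4.]
Nothing here proves K2(p)/K2(5), `NoIsolatedTrap p p` or resolution of singularities in dimension ≥ 4 / char. `p`.

Letters `c` (the chart) and `d ≠ c` (the other active letter); «tilts» `Φ, Ψ, Φ′ : Fin 4 → K` vanishing at
`c` and `d` (supported on the inert letters).  A state of a TILTED binary-cone tail has polar kernel
`⟨e_c + Φ, e_d + Ψ⟩` (`…LossyPairTail.exists_tilted_frame`), its step in the chart `c` translates by
`b = t·e_d + Φ + t·Ψ` (`translation_forced`), the child keeps the `d`-tilt `Ψ` (`tilt_persists`) and acquires a new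
`c`-tilt `Φ′`.  THE IDENTITY (`frame_conjugation`):
`shear_c Φ′ (shear_d Ψ (translate b (chartTransform 5 univ c F))) = chartTransform 5 univ c (shear_c (t·e_d) (Θ F))`,
`Θ : x_i ↦ x_i + Φ_i x_c + Ψ_i x_d + Φ′_i x_c²` — the child STRAIGHTENED BY ITS OWN LINEAR FRAME is the pure-shear
child of the parent RE-COORDINATISED by its linear frame plus the quadratic contact term `Φ′ x_c²` (res-dim4-idea-4
g4's permanent Hasse contact (PC), cut to order 2: the jet shifts down one order per corner).
* §1 the substitutions as `aeval`s and their compatibility with the chart map `coordBlowupSubst`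
  (`shear_other_comp_coordBlowupSubst`, `shear_self_comp_coordBlowupSubst`), the generator identity
  (`frame_substitutions_agree`), **`frame_conjugation`**;
* §2 NOISE: cleaning noise stays on the `5`-th-power lattice under every substitution
  (`coeff_aeval_sub_deletePthPowers`, via `Straightening.aeval_monomial_eq_pow_of_isPthPowerExponent`);
* §3 the two readings FILES 1a–1c consume: **`coeff_step_frame`** (`hS1`/`hS2` shape: coefficient law off the
  lattice between the straightened child `shear_c Φ′ (shear_d Ψ (step … b s).F)` and `shear_c (t e_d) (Θ s.F)`) and
  **`exists_of_mem_support_step_frame`** (support converse).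
Alphabet-abstract: nothing here knows which letters are boundary; any field.
[cite: Hauser2010, §I (definition of P⁺)] [cite: CossartJannsenSaito2020, Thm. 3.14, Thm. 9.3]
bears_on: LADDER-RESOLUTION:D157-DOOR2 (res-dim4-pi · K2(p) = `RidgeBudget.NoAboveFloorTrap p p` · slice C, tilted residual).
Supports stmt-ResolutionOfSingularities-16155 (helper).
-/

set_option linter.dupNamespace false -- mandated namespace of this single-conjunct summit

noncomputable section

namespace Summit.ResolutionOfSingularities.ResolutionOfSingularities.Theorems.PIDim4

namespace ResCone

open MvPolynomial Finset
open Literature.AlgebraicGeometry.Resolution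
open Literature.AlgebraicGeometry.Resolution.CentreBlowup
open Literature.AlgebraicGeometry.Resolution.Hauser2010

variable {K : Type} [Field K]

section Substitutions

/-- `shear` as an algebra homomorphism applied. [folklore] -/
theorem shear_eq_aeval (j : Fin 4) (t : Fin 4 → K) (P : MvPolynomial (Fin 4) K) :
    shear j t P = aeval (fun i => if i = j then (X j : MvPolynomial (Fin 4) K) else X i + C (t i) * X j) P := rfl

/-- **A shear along the OTHER letter commutes with the chart substitution** `σ_c : x_i ↦ x_c x_i (i ≠ c)`:
for `Ψ_c = 0`, `shear_d Ψ ∘ σ_c = σ_c ∘ shear_d Ψ`. [folklore] -/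
theorem shear_other_comp_coordBlowupSubst {c d : Fin 4} (hcd : c ≠ d) (Ψ : Fin 4 → K) (hΨc : Ψ c = 0) :
    (aeval fun i => if i = d then (X d : MvPolynomial (Fin 4) K) else X i + C (Ψ i) * X d).comp
        (coordBlowupSubst K ((Finset.univ : Finset (Fin 4)) : Set (Fin 4)) c) =
      (coordBlowupSubst K ((Finset.univ : Finset (Fin 4)) : Set (Fin 4)) c).comp
        (aeval fun i => if i = d then (X d : MvPolynomial (Fin 4) K) else X i + C (Ψ i) * X d) := by
  refine MvPolynomial.algHom_ext fun i => ?_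
  have hdc : d ≠ c := fun h => hcd h.symm
  by_cases hic : i = c
  · subst hic
    simp [hΨc, hcd]
  · by_cases hid : i = d
    · subst hid
      simp [hcd, hdc, hΨc]
    · simp [hic, hid, hcd, hdc, hΨc]
      ring

/-- **A shear along the CHART letter after the chart substitution is a QUADRATIC jet before it**:
`shear_c Φ′ ∘ σ_c = σ_c ∘ (x_i ↦ x_i + Φ′_i x_c²)`. [folklore] -/
theorem shear_self_comp_coordBlowupSubst (c : Fin 4) (Φ' : Fin 4 → K) :
    (aeval fun i => if i = c then (X c : MvPolynomial (Fin 4) K) else X i + C (Φ' i) * X c).comp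
        (coordBlowupSubst K ((Finset.univ : Finset (Fin 4)) : Set (Fin 4)) c) =
      (coordBlowupSubst K ((Finset.univ : Finset (Fin 4)) : Set (Fin 4)) c).comp
        (aeval fun i => if i = c then (X c : MvPolynomial (Fin 4) K) else X i + C (Φ' i) * X c ^ 2) := by
  refine MvPolynomial.algHom_ext fun i => ?_
  by_cases hic : i = c
  · subst hic
    simp
  · simp [hic]
    ring

/-- **The generator identity behind the frame conjugation**: `(x ↦ x + Φ′x_c²) ∘ shear_d Ψ ∘ shear_c b`
with `b = t e_d + Φ + tΨ` equals `shear_c (t e_d) ∘ Θ`, `Θ : x_i ↦ x_i + Φ_i x_c + Ψ_i x_d + Φ′_i x_c²`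
(tilts vanishing at `c` and `d`). [folklore] -/
theorem frame_substitutions_agree {c d : Fin 4} (hcd : c ≠ d) (t : K) (Φ Ψ Φ' : Fin 4 → K)
    (hΦc : Φ c = 0) (hΦd : Φ d = 0) (hΨc : Ψ c = 0) (hΨd : Ψ d = 0) (hΦ'c : Φ' c = 0) (hΦ'd : Φ' d = 0) :
    ((aeval fun i => if i = c then (X c : MvPolynomial (Fin 4) K) else X i + C (Φ' i) * X c ^ 2).comp
      ((aeval fun i => if i = d then (X d : MvPolynomial (Fin 4) K) else X i + C (Ψ i) * X d).comp
        (aeval fun i => if i = c then (X c : MvPolynomial (Fin 4) K) else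
          X i + C (((Pi.single d t : Fin 4 → K) + Φ + t • Ψ) i) * X c))) =
    (aeval fun i => if i = c then (X c : MvPolynomial (Fin 4) K) else
        X i + C ((Pi.single d t : Fin 4 → K) i) * X c).comp
      (aeval fun i => (X i : MvPolynomial (Fin 4) K) + C (Φ i) * X c + C (Ψ i) * X d + C (Φ' i) * X c ^ 2) := by
  refine MvPolynomial.algHom_ext fun i => ?_
  have hdc : d ≠ c := fun h => hcd h.symm
  by_cases hic : i = c
  · subst hic
    simp [hcd, hΦc, hΨc, hΦ'c]
  · by_cases hid : i = d
    · subst hid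
      simp [hic, hcd, hΦd, hΨd, hΦ'd, hΨc]
    · simp [hic, hid, hcd, hdc, hΨc, hΦ'd]
      ring

end Substitutions

section Conjugation

/-- Shears fix the chart monomial `x_c^n`. [folklore] -/
theorem shear_X_pow_mul (j : Fin 4) (t : Fin 4 → K) (n : ℕ) (P : MvPolynomial (Fin 4) K) :
    shear j t (X j ^ n * P) = X j ^ n * shear j t P := by
  have h := shear_mul j t (X j ^ n) P
  rw [h]
  congr 1
  unfold shear
  rw [map_pow, aeval_X, if_pos rfl]

/-- A shear along `d` fixes `x_c` when `Ψ_c = 0`. [folklore] -/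
theorem shear_other_X_pow_mul {c d : Fin 4} (hcd : c ≠ d) (Ψ : Fin 4 → K) (hΨc : Ψ c = 0) (n : ℕ)
    (P : MvPolynomial (Fin 4) K) : shear d Ψ (X c ^ n * P) = X c ^ n * shear d Ψ P := by
  rw [shear_mul]
  congr 1
  unfold shear
  rw [map_pow, aeval_X, if_neg hcd, hΨc, C_0, zero_mul, add_zero]

/-- **FRAME CONJUGATION** (res-dim4-idea-4 g4's permanent Hasse contact, cut to order two): for a step in the
chart `c` at the point `b = t·e_d + Φ + t·Ψ` (the translation FORCED by a tilted frame `⟨e_c + Φ, e_d + Ψ⟩`,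
`…LossyPairTail.translation_forced`), the chart transform straightened by the CHILD's linear frame `(Φ′ along c,
Ψ along d)` is the pure-shear chart transform of the parent re-coordinatised by
`Θ : x_i ↦ x_i + Φ_i x_c + Ψ_i x_d + Φ′_i x_c²`. [OURS] [cite: Hauser2010, §I (definition of P⁺)]
[cite: CossartJannsenSaito2020, Thm. 3.14, Thm. 9.3] -/
theorem frame_conjugation {c d : Fin 4} (hcd : c ≠ d) (t : K) (Φ Ψ Φ' : Fin 4 → K)
    (hΦc : Φ c = 0) (hΦd : Φ d = 0) (hΨc : Ψ c = 0) (hΨd : Ψ d = 0) (hΦ'c : Φ' c = 0) (hΦ'd : Φ' d = 0)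
    (F : MvPolynomial (Fin 4) K) (hq : ((5 : ℕ) : ℕ∞) ≤ ordAlong Finset.univ F) :
    shear c Φ' (shear d Ψ (PointBlowup.translate ((Pi.single d t : Fin 4 → K) + Φ + t • Ψ)
        (chartTransform 5 Finset.univ c F))) =
      chartTransform 5 Finset.univ c (shear c (Pi.single d t)
        (aeval (fun i => (X i : MvPolynomial (Fin 4) K) + C (Φ i) * X c + C (Ψ i) * X d + C (Φ' i) * X c ^ 2) F)) := by
  set b : Fin 4 → K := (Pi.single d t : Fin 4 → K) + Φ + t • Ψ with hb
  have hbc : b c = 0 := by simp [hb, Pi.single_eq_of_ne hcd, hΦc, hΨc]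
  rw [Straightening.translate_chartTransform_univ_eq_chartTransform_shear 5 c b hbc F hq]
  set ΘF := aeval (fun i => (X i : MvPolynomial (Fin 4) K) + C (Φ i) * X c + C (Ψ i) * X d + C (Φ' i) * X c ^ 2) F
    with hΘF
  have hqG : ((5 : ℕ) : ℕ∞) ≤ ordAlong Finset.univ (shear c b F) := Straightening.le_ordAlong_univ_shear c b hq
  have hqΘ : ((5 : ℕ) : ℕ∞) ≤ ordAlong Finset.univ ΘF :=
    Straightening.le_ordAlong_univ_aeval_of_constantCoeff_eq_zero _ (fun i => by simp) hq
  have hqH : ((5 : ℕ) : ℕ∞) ≤ ordAlong Finset.univ (shear c (Pi.single d t) ΘF) :=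
    Straightening.le_ordAlong_univ_shear c _ hqΘ
  have h1 := ChartDictionary.coordBlowupSubst_eq_X_pow_mul_chartTransform (K := K) (Finset.mem_univ c) 5 _ hqG
  have h2 := ChartDictionary.coordBlowupSubst_eq_X_pow_mul_chartTransform (K := K) (Finset.mem_univ c) 5 _ hqH
  -- apply the two straightening shears to `h1`
  have h3 := congrArg (fun P => shear c Φ' (shear d Ψ P)) h1
  rw [shear_other_X_pow_mul hcd Ψ hΨc, shear_X_pow_mul c Φ'] at h3
  -- the left side of `h3` is `σ_c` of the fully substituted parent, which is `σ_c H`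
  have hleft : shear c Φ' (shear d Ψ (coordBlowupSubst K ((Finset.univ : Finset (Fin 4)) : Set (Fin 4)) c
      (shear c b F))) = coordBlowupSubst K ((Finset.univ : Finset (Fin 4)) : Set (Fin 4)) c
      (shear c (Pi.single d t) ΘF) := by
    have e1 := congrArg (fun φ : MvPolynomial (Fin 4) K →ₐ[K] MvPolynomial (Fin 4) K => φ (shear c b F))
      (shear_other_comp_coordBlowupSubst hcd Ψ hΨc)
    have e2 := congrArg (fun φ : MvPolynomial (Fin 4) K →ₐ[K] MvPolynomial (Fin 4) K =>
      φ (aeval (fun i => if i = d then (X d : MvPolynomial (Fin 4) K) else X i + C (Ψ i) * X d) (shear c b F)))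
      (shear_self_comp_coordBlowupSubst c Φ')
    have e3 := congrArg (fun φ : MvPolynomial (Fin 4) K →ₐ[K] MvPolynomial (Fin 4) K => φ F)
      (frame_substitutions_agree hcd t Φ Ψ Φ' hΦc hΦd hΨc hΨd hΦ'c hΦ'd)
    simp only [AlgHom.comp_apply] at e1 e2 e3
    rw [shear_eq_aeval c Φ', shear_eq_aeval d Ψ, e1, e2, shear_eq_aeval c b, hb, e3, hΘF, shear_eq_aeval c (Pi.single d t)]
  rw [hleft, h2] at h3
  exact (mul_left_cancel₀ (pow_ne_zero 5 (X_ne_zero c)) h3).symm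

end Conjugation

section Noise

/-- **Cleaning noise stays on the `p`-th-power lattice under every substitution**: the coefficients of
`Θ (deletePthPowers p P)` and `Θ P` agree off `IsPthPowerExponent p` (the deleted part is a sum of `p`-th powers,
and so is its image). [folklore] [cite: Hauser2010, §G (cleaning)] -/
theorem coeff_aeval_deletePthPowers (p : ℕ) [Fact p.Prime] [CharP K p] (θ : Fin 4 → MvPolynomial (Fin 4) K)
    (P : MvPolynomial (Fin 4) K) {E : Fin 4 →₀ ℕ} (hE : ¬ IsPthPowerExponent p E) :
    coeff E (aeval θ (deletePthPowers p P)) = coeff E (aeval θ P) := by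
  classical
  have hsplit : P = deletePthPowers p P + ∑ d ∈ P.support with IsPthPowerExponent p d, monomial d (coeff d P) := by
    conv_lhs => rw [P.as_sum]
    rw [← Finset.sum_filter_add_sum_filter_not P.support (IsPthPowerExponent p), add_comm]
    rfl
  conv_rhs => rw [hsplit]
  rw [map_add, coeff_add, map_sum, coeff_sum, Finset.sum_eq_zero, add_zero]
  intro d hd
  obtain ⟨Q, hQ⟩ := Straightening.aeval_monomial_eq_pow_of_isPthPowerExponent p θ (Finset.mem_filter.mp hd).2
    (coeff d P)
  rw [hQ, coeff_smul]
  -- a `p`-th power has `p`-th-power exponents only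
  have hQp : Q ^ p = ∑ m ∈ Q.support, monomial (p • m) (coeff m Q ^ p) := by
    conv_lhs => rw [Q.as_sum]
    rw [sum_pow_char]
    refine Finset.sum_congr rfl fun m _ => ?_
    rw [monomial_pow]
  rw [hQp, coeff_sum, Finset.sum_eq_zero, smul_zero]
  intro m _
  rw [coeff_monomial, if_neg]
  rintro rfl
  exact hE fun i _ => ⟨m i, by simp [Finsupp.smul_apply, smul_eq_mul]⟩

end Noise

section StepReading

variable [DecidableEq K]

/-- **THE STEP IN THE MOVING FRAME, coefficient law** (`hS1`/`hS2` shape of `…LossyTiltFreeLegality`): for the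
state `s`, the step in the chart `c` at the forced point `b = t·e_d + Φ + t·Ψ`, and the child's new `c`-tilt `Φ′`,
the straightened child `shear_c Φ′ (shear_d Ψ (step …).F)` and the pure-shear image of the re-coordinatised parent
`shear_c (t e_d) (Θ s.F)` have the same coefficients at every chart exponent OFF the `5`-th-power lattice. [OURS]
[cite: Hauser2010, §I (definition of P⁺)] [cite: CossartJannsenSaito2020, Thm. 3.14] -/
theorem coeff_step_frame [CharP K 5] {c d : Fin 4} (hcd : c ≠ d) (t : K) (Φ Ψ Φ' : Fin 4 → K)
    (hΦc : Φ c = 0) (hΦd : Φ d = 0) (hΨc : Ψ c = 0) (hΨd : Ψ d = 0) (hΦ'c : Φ' c = 0) (hΦ'd : Φ' d = 0)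
    (s : State K) (hq : ((5 : ℕ) : ℕ∞) ≤ ordAlong Finset.univ s.F) {e : Fin 4 →₀ ℕ} (he : 5 ≤ e.degree)
    (hnp : ¬ IsPthPowerExponent 5 (chartExponent 5 Finset.univ c e)) :
    coeff (chartExponent 5 Finset.univ c e) (shear c Φ' (shear d Ψ
        (CentreBlowup.step 5 Finset.univ c ((Pi.single d t : Fin 4 → K) + Φ + t • Ψ) s).F)) =
      coeff e (shear c (Pi.single d t)
        (aeval (fun i => (X i : MvPolynomial (Fin 4) K) + C (Φ i) * X c + C (Ψ i) * X d + C (Φ' i) * X c ^ 2) s.F)) := by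
  haveI : Fact (Nat.Prime 5) := ⟨by norm_num⟩
  -- the straightening as ONE substitution
  have hcomp : ∀ P : MvPolynomial (Fin 4) K, shear c Φ' (shear d Ψ P) =
      aeval (fun i => aeval (fun l => if l = c then (X c : MvPolynomial (Fin 4) K) else X l + C (Φ' l) * X c)
        (if i = d then (X d : MvPolynomial (Fin 4) K) else X i + C (Ψ i) * X d)) P := by
    intro P
    rw [shear_eq_aeval, shear_eq_aeval, ← AlgHom.comp_apply, comp_aeval]
  change coeff _ (shear c Φ' (shear d Ψ (deletePthPowers 5 (pointTransform 5 Finset.univ c _ s)))) = _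
  rw [hcomp, coeff_aeval_deletePthPowers 5 _ _ hnp, ← hcomp]
  change coeff _ (shear c Φ' (shear d Ψ (PointBlowup.translate _ (chartTransform 5 Finset.univ c s.F)))) = _
  rw [frame_conjugation hcd t Φ Ψ Φ' hΦc hΦd hΨc hΨd hΦ'c hΦ'd s.F hq]
  have hqΘ : ((5 : ℕ) : ℕ∞) ≤ ordAlong Finset.univ (aeval (fun i => (X i : MvPolynomial (Fin 4) K) +
      C (Φ i) * X c + C (Ψ i) * X d + C (Φ' i) * X c ^ 2) s.F) :=
    Straightening.le_ordAlong_univ_aeval_of_constantCoeff_eq_zero _ (fun i => by simp) hq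
  exact coeff_chartTransform_chartExponent' (Straightening.le_ordAlong_univ_shear c _ hqΘ) he

/-- **THE STEP IN THE MOVING FRAME, support converse** (`hS1′` shape): every monomial of the straightened child off
the `5`-th-power lattice is the chart image of a monomial of the pure-shear image of the re-coordinatised parent.
[OURS] [cite: Hauser2010, §I (definition of P⁺)] -/
theorem exists_of_mem_support_step_frame [CharP K 5] {c d : Fin 4} (hcd : c ≠ d) (t : K) (Φ Ψ Φ' : Fin 4 → K)
    (hΦc : Φ c = 0) (hΦd : Φ d = 0) (hΨc : Ψ c = 0) (hΨd : Ψ d = 0) (hΦ'c : Φ' c = 0) (hΦ'd : Φ' d = 0)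
    (s : State K) (hq : ((5 : ℕ) : ℕ∞) ≤ ordAlong Finset.univ s.F) {E : Fin 4 →₀ ℕ}
    (hE : E ∈ (shear c Φ' (shear d Ψ
        (CentreBlowup.step 5 Finset.univ c ((Pi.single d t : Fin 4 → K) + Φ + t • Ψ) s).F)).support)
    (hnp : ¬ IsPthPowerExponent 5 E) :
    ∃ e ∈ (shear c (Pi.single d t)
        (aeval (fun i => (X i : MvPolynomial (Fin 4) K) + C (Φ i) * X c + C (Ψ i) * X d + C (Φ' i) * X c ^ 2)
          s.F)).support, chartExponent 5 Finset.univ c e = E := by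
  haveI : Fact (Nat.Prime 5) := ⟨by norm_num⟩
  have hcomp : ∀ P : MvPolynomial (Fin 4) K, shear c Φ' (shear d Ψ P) =
      aeval (fun i => aeval (fun l => if l = c then (X c : MvPolynomial (Fin 4) K) else X l + C (Φ' l) * X c)
        (if i = d then (X d : MvPolynomial (Fin 4) K) else X i + C (Ψ i) * X d)) P := by
    intro P
    rw [shear_eq_aeval, shear_eq_aeval, ← AlgHom.comp_apply, comp_aeval]
  rw [MvPolynomial.mem_support_iff] at hE
  change coeff E (shear c Φ' (shear d Ψ (deletePthPowers 5 (pointTransform 5 Finset.univ c _ s)))) ≠ 0 at hE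
  rw [hcomp, coeff_aeval_deletePthPowers 5 _ _ hnp, ← hcomp] at hE
  change coeff E (shear c Φ' (shear d Ψ (PointBlowup.translate _ (chartTransform 5 Finset.univ c s.F)))) ≠ 0 at hE
  rw [frame_conjugation hcd t Φ Ψ Φ' hΦc hΦd hΨc hΨd hΦ'c hΦ'd s.F hq] at hE
  unfold chartTransform at hE
  rw [coeff_sum] at hE
  obtain ⟨e, he, hne⟩ := Finset.exists_ne_zero_of_sum_ne_zero hE
  refine ⟨e, he, ?_⟩
  rw [coeff_monomial] at hne
  by_contra h
  exact hne (if_neg h)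

end StepReading

section Invariance

/-- Linear straightening shears preserve the `x_c`-layer `x_c^n ∣ ·` (`Ψ_c = 0`: neither shear lowers an
`x_c`-exponent). [folklore] -/
theorem le_apply_of_mem_support_shear_shear {c d : Fin 4} (hcd : c ≠ d) (Φ' Ψ : Fin 4 → K) (hΨc : Ψ c = 0)
    {P : MvPolynomial (Fin 4) K} {n : ℕ} (hP : ∀ e ∈ P.support, n ≤ e c) {E : Fin 4 →₀ ℕ}
    (hE : E ∈ (shear c Φ' (shear d Ψ P)).support) : n ≤ E c := by
  classical
  have hdiv : P = monomial (Finsupp.single c n) (1 : K) * P.divMonomial (Finsupp.single c n) :=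
    eq_monomial_mul_divMonomial fun e he => Finsupp.single_le_iff.mpr (hP e he)
  have hXn : (X c : MvPolynomial (Fin 4) K) ^ n = monomial (Finsupp.single c n) 1 := X_pow_eq_monomial
  rw [hdiv, ← hXn, shear_other_X_pow_mul hcd Ψ hΨc, shear_X_pow_mul c Φ', hXn, MvPolynomial.mem_support_iff,
    coeff_monomial_mul'] at hE
  by_cases hle : Finsupp.single c n ≤ E
  · exact Finsupp.single_le_iff.mp hle
  · exact absurd (if_neg hle) hE

end Invariance

end ResCone

end Summit.ResolutionOfSingularities.ResolutionOfSingularities.Theorems.PIDim4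

end
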